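import Literature.MathematicalPhysics.QuantumFieldTheory.Balaban1983to89.B8Eq191FlatDirichletLipschitzExponent
import Literature.MathematicalPhysics.QuantumFieldTheory.Balaban1983to89.B8Eq191FlatDirichletForm
import Literature.MathematicalPhysics.QuantumFieldTheory.Balaban1983to89.B6Lemma21Arith

/-!
# `Balaban1983to89.B8Eq191FlatDirichletWall` — THE WALL PIECE of [Balaban1985RegularSpaces] (1.101) p. 93 at `U₀ = 1` for the flat Dirichlet multi-level
# matrix: pointwise exponential decay and a weighted row bound for the inverse of its principal submatrix on a site set whose towers have levels `≤ 1`
# ([Balaban1984PropagatorsII] p. 228 «the operators G(Ω) … with minor and obvious changes», (2.46) p. 231, Lemma 2.1 (2.61) p. 234, p. 233)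

statement-level skeleton of published theorems with citation tags; proofs where landed; nothing here is a claim about the
Yang–Mills mass gap

`[Balaban1985RegularSpaces]` ("B8", CMP **99** (1985) 75–102) (1.101) p. 93 («G′ is a bounded operator from a space with the norm |·|₍₋₂₎ into a space with
the norm |·| for functions»), p. 98 (the cube family, collars `R₁M₁Lʲη`); `[Balaban1984PropagatorsI]` ("B5"… [B4] companion, CMP **95**) p. 36 (exponential
weights); `[Balaban1984PropagatorsII]` ("B6", CMP **96** (1984) 223–250) p. 228–229 (Green's functions `G(Ω)` with boundary conditions), (2.46) p. 231, Lemma 2.1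
(2.60)–(2.61) p. 234, p. 233 («c₀(α) = Σ_{z∈ℤ} e^{−αδ₀|z|}»).  PDF held: `paper:balaban1985-cmp99-regular-spaces-gauge-fixing`.

CITATION HEADER (lean-in-tree rule).  Cell `pub-ymgap` (YM Track A, HUMAN RULING D-0062), DAG node N05 = [B8], seat `pub-ymgap-dag-n05-c` (g9; (R1′)-v2 HYBRID
route for the REAL-1 family (1.101) of `B8Prop6CubeMemberFlatScalar.prop6_cubeMember_flat_of_real`, file F3).  The hybrid route splits the consumer's Dirichlet
carrier `□₀` into region A (a Neumann box around `□₁` carrying levels `1 … n`, where p21's hypothesis-free chain gives (1.101): F1 `B8CubeMemberBoxDomains`,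
F2 `B8CubeMemberBoxRows`) and region B = THE WALL: the level-0 collar `□₀ ∖ □₁` together with a strip of whole level-1 blocks of `□₁` — a site set on
which every tower has level `≤ 1`.  THIS FILE proves, for ANY such site set `W` (towers inside `W`, one level per site, levels `≤ 1`), that the inverse of
the principal submatrix `K|_W` decays exponentially in the `ℓ¹` distance at rate `δ′∕L` with prefactor `(Lη)²∕(a₀(1−θ))`, and is therefore bounded from the
`(−2)`-weighted sup norm to the sup norm by `L²c₀(δ′∕L)^d∕(a₀(1−θ))` — a constant of `d, L` only.  Mechanism: this base's g8 bricks 1–3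
(`B8Eq191FlatDirichletLipschitzExponent.agmon_solve_flatDirichlet_of_lipschitz`, which is stated for an arbitrary site set) with the exponent
`ρ = (δ′∕L)|· − z|₁` (bond-Lipschitz with constant `δ′∕L ≤ δ′L^{−j}` precisely because `j ≤ 1`) and the source `δ_z`; at levels `≤ 1` the site weight is
`≥ a₀(Lη)⁻²`, so the weighted-`ℓ²` estimate yields the ENTRY bound with no local-regularity step (the step that is expensive at deep levels is done inside
region A by p21's chain).

WHAT THIS FILE PROVES (kernel-checked; theorems only; generic dimension `d ≥ 1`, `η ≠ 0`, `L ≥ 1`, restriction sets `Λs`, weights `a_j > 0` with normalised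
weights `a′_j = a_jη²L^{2j}L^{−dj} ∈ [a₀, 8]`, `0 < a₀ ≤ 8`; brick 3's window `0 < δ′ ≤ 1`, `dδ′ ≤ 1`, `4dδ′² ≤ θa₀`, `2d²δ′² ≤ θ < 1`).
* §1 `l1dist_self`, `l1dist_nonneg`, `abs_l1dist_step_le` (the `ℓ¹` distance `B8Eq131Cubes.l1dist` is `1`-Lipschitz per bond).
* §2 `sum_exp_abs_Icc_le` (one coordinate against `c₀`), ★ `sum_exp_l1dist_le` (`Σ_{z∈S} e^{−c|x−z|₁} ≤ c₀(c)^d` for EVERY finite `S ⊂ ℤᵈ`, by factorisation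
  over the coordinates of a box around `x` ⊇ `S` and `B6Lemma21Arith.summable_c0_term`), `one_le_c0`.
* §3 `siteWeight_ge`: brick 1's site weight is `≥ a₀(Lη)⁻²` on a site set whose towers have levels `≤ 1`.
* §4 ★★ `wall_green_decay`: `|(K|_W)⁻¹(x, z)| ≤ (Lη)²∕(a₀(1 − θ))·e^{−(δ′∕L)|x − z|₁}` for all `x, z ∈ W` (`K|_W` is a unit by n05-e's
  `B8Eq191FlatDirichletForm.isUnit_flatMatrix`; the column `(K|_W)⁻¹(·, z)` solves `Kg = δ_z` on `W`; Agmon with `ρ = (δ′∕L)|· − z|₁`).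
* §5 ★★ `wall_rowBound`: `|Σ_{z∈W}(K|_W)⁻¹(x,z)u(z)| ≤ L²∕(a₀(1−θ))·c₀(δ′∕L)^d·N` whenever `|u| ≤ Nη⁻²` on `W` — the (1.101) function bound of the wall
  piece, uniform in `η`, the number of levels, the cube datum and the size of `W`.

HONEST SCOPE ∕ NOT CLAIMED.  A weighted-`ℓ²` Combes–Thomas∕Agmon estimate read entrywise at levels `≤ 1`; nothing at deep levels (there the entry bound would
lose the block volume `L^{dj}` — that regime is region A's).  The gradient member of (1.101) on the wall follows from the sup bound at levels `≤ 1` (a factor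
`2L`, taken in the parametrix file); no Hölder∕Laplacian entry here.  The rate `δ′∕L` and the constant `c₀(δ′∕L)^d` are far from print's; only uniformity
matters for the consumer.  Count-neutral; N05 NOT discharged; one finite `T⁴` programme at fixed `ε`, Bałaban as printed; nothing continuum ∕ ℝ⁴ ∕ OS ∕
mass-gap ∕ Clay.  No `sorry`, no `def`, no `instance`, no `notation`.  Unit `pub-ymgap-dag-n05-c` (g9), 2026-08-27.

RELATED IN THE TREE, NOT DUPLICATED: `B8Eq191FlatDirichletLipschitzExponent.agmon_solve_flatDirichlet_of_lipschitz` ∕ `…Conjugation.*` ∕ `…Coercive.*` (USED BY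
NAME), `B8Eq191FlatDirichletForm.isUnit_flatMatrix` (USED), `B6Lemma21Arith.summable_c0_term` + `B6.c0` (USED), `B6Lemma21OneScaleTorus.sum_exp_torusL1_le` (the
torus twin of §2), `B10Eq45LatticeSum.sum_exp_neg_l1dist_le` (`d = 3` with an explicit constant; here every `d` against `c₀`), `B8Eq191FlatDirichletCollarDecay`
∕ `…Counting` (g8's deep-level collar decay and counting — not needed on the wall).
-/
noncomputable section

namespace Literature.MathematicalPhysics.QuantumFieldTheory.Balaban1983to89.B8Eq191FlatDirichletWall

open B7Prop1Explicit (e)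
open B8Eq131Cubes (l1dist)
open B8Eq191FlatDirichletLipschitzExponent (agmon_solve_flatDirichlet_of_lipschitz)
open B8Eq191FlatDirichletForm (isUnit_flatMatrix)
open B6Lemma21Arith (summable_c0_term)
open Literature.MathematicalPhysics.QuantumLattice (blockMap)

variable {d : ℕ}

/-! ## §1 The `ℓ¹` distance of the fine lattice: value at coincident points, one-step Lipschitz -/

/-- `|x − x|₁ = 0`. [folklore] [cite: Balaban1984PropagatorsII, (2.46) p.231] -/
theorem l1dist_self (x : Fin d → ℤ) : l1dist x x = 0 := by
  unfold l1dist; simp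

/-- `0 ≤ |x − y|₁`. [folklore] [cite: Balaban1984PropagatorsII, (2.46) p.231] -/
theorem l1dist_nonneg (x y : Fin d → ℤ) : 0 ≤ l1dist x y := by
  unfold l1dist; exact Finset.sum_nonneg fun i _ => abs_nonneg _

/-- One lattice step changes the `ℓ¹` distance by at most one: `| |x + e_μ − z|₁ − |x − z|₁ | ≤ 1`, and the same for `x − e_μ`.
[folklore] [cite: Balaban1984PropagatorsII, (2.46) p.231] -/
theorem abs_l1dist_step_le (x z : Fin d → ℤ) (μ : Fin d) :
    |l1dist (x + e μ) z - l1dist x z| ≤ 1 ∧ |l1dist (x - e μ) z - l1dist x z| ≤ 1 := by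
  have key : ∀ (s : ℤ), |s| = 1 → |l1dist (x + s • e μ) z - l1dist x z| ≤ 1 := by
    intro s hs
    unfold l1dist
    rw [← Finset.sum_sub_distrib]
    have hterm : ∀ i, |(x + s • e μ) i - z i| - |x i - z i| = if i = μ then |x μ + s - z μ| - |x μ - z μ| else 0 := by
      intro i
      by_cases hi : i = μ
      · subst hi; simp [e]
      · simp [e, hi]
    rw [Finset.sum_congr rfl fun i _ => hterm i, Finset.sum_ite_eq' Finset.univ μ, if_pos (Finset.mem_univ _)]
    have h1 := abs_abs_sub_abs_le (x μ + s - z μ) (x μ - z μ)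
    rw [show x μ + s - z μ - (x μ - z μ) = s by ring, hs] at h1
    exact h1
  constructor
  · simpa using key 1 (by simp)
  · have h := key (-1) (by simp)
    simpa [sub_eq_add_neg] using h

/-! ## §2 The lattice exponential sum `Σ_{z∈S} e^{−c|x−z|₁} ≤ c₀(c)^d` (`c₀(c) = Σ_{m∈ℤ} e^{−c|m|}` of [B6] p. 233) -/

/-- One coordinate: `Σ_{m ∈ [lo, hi]} e^{−c|x₀ − m|} ≤ c₀(c)`. [cite: Balaban1984PropagatorsII, p.233 («c₀(α) = Σ_{z∈ℤ} e^{−αδ₀|z|}»), Lemma 2.1 (2.61) p.234] -/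
theorem sum_exp_abs_Icc_le {c : ℝ} (hc : 0 < c) (lo hi x₀ : ℤ) :
    ∑ m ∈ Finset.Icc lo hi, Real.exp (-(c * 1 * |((x₀ - m : ℤ) : ℝ)|)) ≤ B6.c0 1 c := by
  classical
  have hinj : Set.InjOn (fun m : ℤ => x₀ - m) (Finset.Icc lo hi : Set ℤ) := fun a _ b _ h => by simpa using h
  have hsum := summable_c0_term (δ₀ := 1) (α := c) (by simpa using hc)
  calc ∑ m ∈ Finset.Icc lo hi, Real.exp (-(c * 1 * |((x₀ - m : ℤ) : ℝ)|))
      = ∑ z ∈ (Finset.Icc lo hi).image (fun m : ℤ => x₀ - m), Real.exp (-(c * 1 * |(z : ℝ)|)) := by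
        rw [Finset.sum_image hinj]
    _ ≤ ∑' z : ℤ, Real.exp (-(c * 1 * |(z : ℝ)|)) :=
        hsum.sum_le_tsum _ (fun z _ => (Real.exp_pos _).le)
    _ = B6.c0 1 c := rfl

/-- **`Σ_{z∈S} e^{−c|x−z|₁} ≤ c₀(c)^d` for every finite `S ⊂ ℤᵈ`** (factorisation over coordinates inside a box containing `S`).
[cite: Balaban1984PropagatorsII, Lemma 2.1 (2.61) p.234, count p.233] -/
theorem sum_exp_l1dist_le {c : ℝ} (hc : 0 < c) (S : Finset (Fin d → ℤ)) (x : Fin d → ℤ) :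
    ∑ z ∈ S, Real.exp (-(c * (l1dist x z : ℝ))) ≤ B6.c0 1 c ^ d := by
  classical
  -- a box around `x` containing `S`
  set R : ℕ := S.sup fun z => Finset.univ.sup fun i => (z i - x i).natAbs with hR
  set box : Finset (Fin d → ℤ) := Fintype.piFinset fun i => Finset.Icc (x i - R) (x i + R) with hbox
  have hsub : S ⊆ box := by
    intro z hz
    rw [hbox, Fintype.mem_piFinset]
    intro i
    have h1 : (z i - x i).natAbs ≤ R := by
      rw [hR]
      exact le_trans (Finset.le_sup (f := fun i => (z i - x i).natAbs) (Finset.mem_univ i))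
        (Finset.le_sup (f := fun z => Finset.univ.sup fun i => (z i - x i).natAbs) hz)
    have h2 : |z i - x i| ≤ (R : ℤ) := by rw [← Int.natCast_natAbs]; exact_mod_cast h1
    rw [Finset.mem_Icc]
    constructor <;> linarith [abs_le.mp h2]
  -- factorise
  have hfac : ∀ z : Fin d → ℤ, Real.exp (-(c * (l1dist x z : ℝ))) = ∏ i, Real.exp (-(c * 1 * |((x i - z i : ℤ) : ℝ)|)) := by
    intro z
    rw [← Real.exp_sum]
    congr 1
    unfold l1dist
    push_cast
    rw [Finset.mul_sum, ← Finset.sum_neg_distrib]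
    simp
  calc ∑ z ∈ S, Real.exp (-(c * (l1dist x z : ℝ)))
      ≤ ∑ z ∈ box, Real.exp (-(c * (l1dist x z : ℝ))) :=
        Finset.sum_le_sum_of_subset_of_nonneg hsub fun z _ _ => (Real.exp_pos _).le
    _ = ∑ z ∈ box, ∏ i, Real.exp (-(c * 1 * |((x i - z i : ℤ) : ℝ)|)) := Finset.sum_congr rfl fun z _ => hfac z
    _ = ∏ i, ∑ m ∈ Finset.Icc (x i - R) (x i + R), Real.exp (-(c * 1 * |((x i - m : ℤ) : ℝ)|)) := by
        rw [hbox, Finset.prod_univ_sum]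
    _ ≤ ∏ _i : Fin d, B6.c0 1 c :=
        Finset.prod_le_prod (fun i _ => Finset.sum_nonneg fun m _ => (Real.exp_pos _).le)
          fun i _ => sum_exp_abs_Icc_le hc _ _ _
    _ = B6.c0 1 c ^ d := by rw [Finset.prod_const, Finset.card_univ, Fintype.card_fin]

/-- `1 ≤ c₀(c)` (the term `m = 0`). [cite: Balaban1984PropagatorsII, p.233] -/
theorem one_le_c0 {c : ℝ} (hc : 0 < c) : 1 ≤ B6.c0 1 c := by
  have h := sum_exp_abs_Icc_le hc 0 0 0
  simpa using h

/-! ## §3 The site weight at levels `≤ 1` -/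

open Classical in
/-- On a site set whose towers have levels `≤ 1`, with normalised weights `a′_j ≥ a₀` (`a₀ ≤ 8`), brick 1's site weight is at least `a₀·(Lη)⁻²`:
`ω(y) = min{8, a′_{j(y)}}·(L^{j(y)}η)⁻² ≥ a₀(Lη)⁻²`. [cite: Balaban1984PropagatorsII, (2.26)–(2.27) p.235, p.228; Balaban1985RegularSpaces, (1.101) p.93] -/
theorem siteWeight_ge {η : ℝ} {L : ℕ} (hL : 1 ≤ L) (m : ℕ) (Λs : ℕ → Set (Fin d → ℤ)) (a : ℕ → ℝ) (ha : ∀ j, 0 < a j)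
    (W : Finset (Fin d → ℤ))
    (hcover : ∀ x ∈ W, ∃ j, j ≤ m ∧ blockMap (L ^ j) x ∈ Λs j)
    (hlow : ∀ x ∈ W, ∀ j, j ≤ m → blockMap (L ^ j) x ∈ Λs j → j ≤ 1)
    {a₀ : ℝ} (ha₀ : 0 < a₀) (ha₀8 : a₀ ≤ 8) (hlo : ∀ j, j ≤ m → a₀ ≤ a j * η ^ 2 * ((L : ℝ) ^ j) ^ 2 * (((L : ℝ) ^ d) ^ j)⁻¹)
    (y : Fin d → ℤ) (hy : y ∈ W) :
    a₀ * (((L : ℝ) * η) ^ 2)⁻¹ ≤ (fun x => ∑ j ∈ Finset.range (m + 1), (if blockMap (L ^ j) x ∈ Λs j then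
      min 8 (a j * η ^ 2 * ((L : ℝ) ^ j) ^ 2 * (((L : ℝ) ^ d) ^ j)⁻¹) * (((L : ℝ) ^ j * η) ^ 2)⁻¹ else 0)) y := by
  have hL1 : (1 : ℝ) ≤ L := by exact_mod_cast hL
  obtain ⟨j₀, hj₀m, hyj₀⟩ := hcover y hy
  have hj₀1 : j₀ ≤ 1 := hlow y hy j₀ hj₀m hyj₀
  have hW : ∀ j, 0 ≤ (if blockMap (L ^ j) y ∈ Λs j then
      min 8 (a j * η ^ 2 * ((L : ℝ) ^ j) ^ 2 * (((L : ℝ) ^ d) ^ j)⁻¹) * (((L : ℝ) ^ j * η) ^ 2)⁻¹ else 0) := by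
    intro j
    split_ifs
    · exact mul_nonneg (le_min (by norm_num) (by have := (ha j).le; positivity)) (by positivity)
    · exact le_rfl
  refine le_trans ?_ (Finset.single_le_sum (fun j _ => hW j) (Finset.mem_range.mpr (Nat.lt_succ_of_le hj₀m)))
  rw [if_pos hyj₀]
  -- `min 8 a′ ≥ a₀` and `(L^{j₀}η)² ≤ (Lη)²`
  have h1 : a₀ ≤ min 8 (a j₀ * η ^ 2 * ((L : ℝ) ^ j₀) ^ 2 * (((L : ℝ) ^ d) ^ j₀)⁻¹) := le_min ha₀8 (hlo j₀ hj₀m)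
  have h2 : ((L : ℝ) ^ j₀ * η) ^ 2 ≤ ((L : ℝ) * η) ^ 2 := by
    have hpow : (L : ℝ) ^ j₀ ≤ (L : ℝ) := by
      calc (L : ℝ) ^ j₀ ≤ (L : ℝ) ^ 1 := pow_le_pow_right₀ hL1 hj₀1
        _ = L := pow_one _
    rw [mul_pow, mul_pow]
    exact mul_le_mul_of_nonneg_right (pow_le_pow_left₀ (by positivity) hpow 2) (sq_nonneg η)
  by_cases hη : η = 0
  · subst hη
    simp only [mul_zero, ne_eq, OfNat.ofNat_ne_zero, not_false_eq_true, zero_pow, inv_zero]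
    exact le_refl _
  · have hpos : 0 < ((L : ℝ) ^ j₀ * η) ^ 2 := by positivity
    exact mul_le_mul h1 (inv_anti₀ hpos h2) (by positivity) (le_trans ha₀.le h1)

/-! ## §4 The wall Green's function: pointwise exponential decay -/

open Classical in
/-- **POINTWISE EXPONENTIAL DECAY OF THE WALL GREEN'S FUNCTION.**  Let `K` be the flat Dirichlet multi-level matrix (any `η ≠ 0`, `L ≥ 1`, restriction
sets `Λs`, weights with `a′_j ∈ [a₀, 8]`, `0 < a₀ ≤ 8`) and `W` a finite site set whose live tower blocks lie in `W` (`hfull`), are pairwise of one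
level (`hdisj`), cover `W` (`hcover`) and have levels `≤ 1` (`hlow`).  Then the inverse `G = (K|_W)⁻¹` of the principal submatrix satisfies, for
`δ′, θ` in brick 3's window (`δ′ ≤ 1`, `dδ′ ≤ 1`, `4dδ′² ≤ θa₀`, `2d²δ′² ≤ θ < 1`):
`|G(x, z)| ≤ (Lη)²∕(a₀(1 − θ)) · e^{−(δ′∕L)|x − z|₁}` — Agmon's estimate of bricks 1–3 with the bond-Lipschitz exponent `ρ = (δ′∕L)|· − z|₁` and the
source `δ_z`; at levels `≤ 1` the passage from the weighted `ℓ²` bound to the entry costs nothing but the factor `(Lη)²∕a₀`.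
[cite: Balaban1985RegularSpaces, (1.101) p.93, p.98; Balaban1984PropagatorsI, p.36; Balaban1984PropagatorsII, p.228 («the operators G(Ω) … with minor and obvious changes»), (2.46) p.231] -/
theorem wall_green_decay (hd : 0 < d) {η : ℝ} (hη : η ≠ 0) {L : ℕ} (hL : 1 ≤ L) (m : ℕ) (Λs : ℕ → Set (Fin d → ℤ)) (a : ℕ → ℝ)
    (ha : ∀ j, 0 < a j) (K : (Fin d → ℤ) → (Fin d → ℤ) → ℝ)
    (hK : ∀ x z, K x z = ((η ^ 2)⁻¹ * ∑ μ : Fin d, ((2 : ℝ) * (if z = x then (1 : ℝ) else 0) - (if z = x + e μ then (1 : ℝ) else 0)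
        - (if z = x - e μ then (1 : ℝ) else 0))) +
        (∑ j ∈ Finset.range (m + 1), (if blockMap (L ^ j) x ∈ Λs j ∧ blockMap (L ^ j) z = blockMap (L ^ j) x then
          a j * ((((L : ℝ) ^ d)⁻¹) ^ j) ^ 2 else 0)))
    (W : Finset (Fin d → ℤ))
    (hfull : ∀ j, j ≤ m → ∀ x ∈ W, blockMap (L ^ j) x ∈ Λs j → ∀ z, blockMap (L ^ j) z = blockMap (L ^ j) x → z ∈ W)
    (hdisj : ∀ x ∈ W, ∀ j, j ≤ m → ∀ j', j' ≤ m → blockMap (L ^ j) x ∈ Λs j → blockMap (L ^ j') x ∈ Λs j' → j = j')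
    (hcover : ∀ x ∈ W, ∃ j, j ≤ m ∧ blockMap (L ^ j) x ∈ Λs j)
    (hlow : ∀ x ∈ W, ∀ j, j ≤ m → blockMap (L ^ j) x ∈ Λs j → j ≤ 1)
    {a₀ : ℝ} (ha₀ : 0 < a₀) (ha₀8 : a₀ ≤ 8) (hlo : ∀ j, j ≤ m → a₀ ≤ a j * η ^ 2 * ((L : ℝ) ^ j) ^ 2 * (((L : ℝ) ^ d) ^ j)⁻¹)
    (hhi : ∀ j, j ≤ m → a j * η ^ 2 * ((L : ℝ) ^ j) ^ 2 * (((L : ℝ) ^ d) ^ j)⁻¹ ≤ 8)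
    {δ' θ : ℝ} (hδ0 : 0 ≤ δ') (hδ1 : δ' ≤ 1) (hδd : (d : ℝ) * δ' ≤ 1) (hδa : 4 * (d : ℝ) * δ' ^ 2 ≤ θ * a₀)
    (hδθ : 2 * (d : ℝ) ^ 2 * δ' ^ 2 ≤ θ) (hθ1 : θ < 1)
    (x z : ↥W) :
    |(Matrix.of fun x z : ↥W => K x.1 z.1)⁻¹ x z|
      ≤ ((L : ℝ) * η) ^ 2 / (a₀ * (1 - θ)) * Real.exp (-(δ' / L * (l1dist x.1 z.1 : ℝ))) := by
  have hL0 : (0 : ℝ) < L := by exact_mod_cast hL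
  have hL1 : (1 : ℝ) ≤ L := by exact_mod_cast hL
  set T : Matrix ↥W ↥W ℝ := Matrix.of fun x z : ↥W => K x.1 z.1 with hT
  set G := T⁻¹ with hG
  have hTunit : IsUnit T := isUnit_flatMatrix hd hη L m Λs a (fun j => (ha j).le) K hK W
  have hTG : T * G = 1 := Matrix.mul_nonsing_inv T ((Matrix.isUnit_iff_isUnit_det T).mp hTunit)
  -- the column of `G` at `z`, as a lattice function supported in `W`, solves `K g = δ_z` on `W`
  set g : (Fin d → ℤ) → ℝ := fun y => if h : y ∈ W then G ⟨y, h⟩ z else 0 with hg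
  set f : (Fin d → ℤ) → ℝ := fun y => if y = z.1 then 1 else 0 with hf
  have hgW : ∀ y, y ∉ W → g y = 0 := fun y hy => by simp only [hg, dif_neg hy]
  have hgval : ∀ y : ↥W, g y.1 = G y z := fun y => by simp only [hg, dif_pos y.2]
  have hKg : ∀ y ∈ W, ∑ y' ∈ W, K y y' * g y' = f y := by
    intro y hy
    have h1 : ∑ y' ∈ W, K y y' * g y' = ∑ y' : ↥W, K y y'.1 * G y' z := by
      rw [← Finset.sum_coe_sort W]
      exact Finset.sum_congr rfl fun y' _ => by rw [hgval]
    have h2 : ∑ y' : ↥W, K y y'.1 * G y' z = (T * G) ⟨y, hy⟩ z := by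
      rw [Matrix.mul_apply]
      exact Finset.sum_congr rfl fun y' _ => by rw [hT, Matrix.of_apply]
    rw [h1, h2, hTG, Matrix.one_apply]
    simp only [hf, Subtype.ext_iff]
  -- the exponent `ρ = (δ′/L)|· − z|₁` is bond-Lipschitz at levels `≤ 1`
  set ρ : (Fin d → ℤ) → ℝ := fun y => δ' / L * (l1dist y z.1 : ℝ) with hρ
  have hlip : ∀ y ∈ W, ∀ j, j ≤ m → blockMap (L ^ j) y ∈ Λs j → ∀ μ : Fin d,
      (y + e μ ∈ W → |ρ y - ρ (y + e μ)| ≤ δ' * (((L : ℝ) ^ j))⁻¹) ∧ (y - e μ ∈ W → |ρ y - ρ (y - e μ)| ≤ δ' * (((L : ℝ) ^ j))⁻¹) := by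
    intro y hy j hjm hyj μ
    have hj1 : j ≤ 1 := hlow y hy j hjm hyj
    have hLj : δ' / L ≤ δ' * ((L : ℝ) ^ j)⁻¹ := by
      rw [div_eq_mul_inv]
      refine mul_le_mul_of_nonneg_left (inv_anti₀ (by positivity) ?_) hδ0
      calc (L : ℝ) ^ j ≤ (L : ℝ) ^ 1 := pow_le_pow_right₀ hL1 hj1
        _ = L := pow_one _
    obtain ⟨hs1, hs2⟩ := abs_l1dist_step_le y z.1 μ
    have key : ∀ y' : Fin d → ℤ, |l1dist y' z.1 - l1dist y z.1| ≤ 1 → |ρ y - ρ y'| ≤ δ' * ((L : ℝ) ^ j)⁻¹ := by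
      intro y' h
      have h' : |((l1dist y' z.1 : ℤ) : ℝ) - (l1dist y z.1 : ℝ)| ≤ 1 := by exact_mod_cast h
      calc |ρ y - ρ y'| = δ' / L * |((l1dist y' z.1 : ℤ) : ℝ) - (l1dist y z.1 : ℝ)| := by
            rw [hρ]; dsimp only
            rw [← mul_sub, abs_mul, abs_of_nonneg (by positivity), ← abs_neg]; ring_nf
        _ ≤ δ' / L * 1 := mul_le_mul_of_nonneg_left h' (by positivity)
        _ ≤ δ' * ((L : ℝ) ^ j)⁻¹ := by rw [mul_one]; exact hLj
    exact ⟨fun _ => key _ hs1, fun _ => key _ hs2⟩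
  -- Agmon
  have hA := agmon_solve_flatDirichlet_of_lipschitz hη hL m Λs a ha K hK W hfull hdisj hcover ha₀.le hlo hhi ρ hδ0 hδ1 hδd hδa hδθ hθ1
    hlip g f hgW hKg
  -- abbreviate the site weight
  set ω : (Fin d → ℤ) → ℝ := fun x => ∑ j ∈ Finset.range (m + 1), (if blockMap (L ^ j) x ∈ Λs j then
      min 8 (a j * η ^ 2 * ((L : ℝ) ^ j) ^ 2 * (((L : ℝ) ^ d) ^ j)⁻¹) * (((L : ℝ) ^ j * η) ^ 2)⁻¹ else 0) with hω
  have hωge : ∀ y ∈ W, a₀ * (((L : ℝ) * η) ^ 2)⁻¹ ≤ ω y := fun y hy =>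
    siteWeight_ge hL m Λs a ha W hcover hlow ha₀ ha₀8 hlo y hy
  have hc0 : 0 < a₀ * (((L : ℝ) * η) ^ 2)⁻¹ := by positivity
  have hωpos : ∀ y ∈ W, 0 < ω y := fun y hy => lt_of_lt_of_le hc0 (hωge y hy)
  -- right-hand side: only the source site contributes
  have hρz : ρ z.1 = 0 := by rw [hρ]; dsimp only; rw [l1dist_self]; simp
  have hRHS : ∑ y ∈ W, (ω y)⁻¹ * Real.exp (2 * ρ y) * f y ^ 2 = (ω z.1)⁻¹ := by
    rw [Finset.sum_eq_single z.1]
    · rw [hρz]; simp [hf]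
    · intro y _ hyz; simp [hf, hyz]
    · intro h; exact absurd z.2 h
  -- left-hand side: keep the term at `x`
  have hterm : ∀ y ∈ W, 0 ≤ ω y * Real.exp (2 * ρ y) * g y ^ 2 := fun y hy =>
    mul_nonneg (mul_nonneg (hωpos y hy).le (Real.exp_pos _).le) (sq_nonneg _)
  have hLHS : ω x.1 * Real.exp (2 * ρ x.1) * g x.1 ^ 2 ≤ ∑ y ∈ W, ω y * Real.exp (2 * ρ y) * g y ^ 2 :=
    Finset.single_le_sum hterm x.2
  have hmain : (1 - θ) ^ 2 * (ω x.1 * Real.exp (2 * ρ x.1) * g x.1 ^ 2) ≤ (ω z.1)⁻¹ := by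
    have h1 : (1 - θ) ^ 2 * (ω x.1 * Real.exp (2 * ρ x.1) * g x.1 ^ 2)
        ≤ (1 - θ) ^ 2 * ∑ y ∈ W, ω y * Real.exp (2 * ρ y) * g y ^ 2 := mul_le_mul_of_nonneg_left hLHS (sq_nonneg _)
    have h2 := hA
    rw [hRHS] at h2
    exact le_trans h1 h2
  -- unwind: `(1−θ)²·A·e^{2ρ}·g² ≤ A⁻¹` with `A = a₀(Lη)⁻² ≤ ω`
  have hθ0 : 0 < 1 - θ := by linarith
  set A : ℝ := a₀ * (((L : ℝ) * η) ^ 2)⁻¹ with hAdef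
  have hωx : A ≤ ω x.1 := hωge x.1 x.2
  have hωz : (ω z.1)⁻¹ ≤ A⁻¹ := inv_anti₀ hc0 (hωge z.1 z.2)
  have hexp : 0 < Real.exp (2 * ρ x.1) := Real.exp_pos _
  have h3 : (1 - θ) ^ 2 * A * Real.exp (2 * ρ x.1) * g x.1 ^ 2 ≤ A⁻¹ := by
    calc (1 - θ) ^ 2 * A * Real.exp (2 * ρ x.1) * g x.1 ^ 2
        = ((1 - θ) ^ 2 * (Real.exp (2 * ρ x.1) * g x.1 ^ 2)) * A := by ring
      _ ≤ ((1 - θ) ^ 2 * (Real.exp (2 * ρ x.1) * g x.1 ^ 2)) * ω x.1 :=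
          mul_le_mul_of_nonneg_left hωx (by positivity)
      _ = (1 - θ) ^ 2 * (ω x.1 * Real.exp (2 * ρ x.1) * g x.1 ^ 2) := by ring
      _ ≤ (ω z.1)⁻¹ := hmain
      _ ≤ A⁻¹ := hωz
  -- hence `g(x)² ≤ (C·e^{−ρ x})²`, `C = ((1−θ)A)⁻¹ = (Lη)²/(a₀(1−θ))`
  set C : ℝ := ((L : ℝ) * η) ^ 2 / (a₀ * (1 - θ)) with hC
  have hLη : 0 < ((L : ℝ) * η) ^ 2 := by positivity
  have hg2 : g x.1 ^ 2 ≤ A⁻¹ / ((1 - θ) ^ 2 * A * Real.exp (2 * ρ x.1)) := by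
    rw [le_div_iff₀ (by positivity)]
    calc g x.1 ^ 2 * ((1 - θ) ^ 2 * A * Real.exp (2 * ρ x.1))
        = (1 - θ) ^ 2 * A * Real.exp (2 * ρ x.1) * g x.1 ^ 2 := by ring
      _ ≤ A⁻¹ := h3
  have hexp2 : Real.exp (-(ρ x.1)) ^ 2 = (Real.exp (2 * ρ x.1))⁻¹ := by
    rw [← Real.exp_nat_mul, ← Real.exp_neg]
    push_cast
    ring_nf
  have hCeq : (C * Real.exp (-(ρ x.1))) ^ 2 = A⁻¹ / ((1 - θ) ^ 2 * A * Real.exp (2 * ρ x.1)) := by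
    rw [mul_pow, hexp2, hC, hAdef]
    field_simp
  have hsq : g x.1 ^ 2 ≤ (C * Real.exp (-(ρ x.1))) ^ 2 := by rw [hCeq]; exact hg2
  have hCexp : 0 ≤ C * Real.exp (-(ρ x.1)) := by positivity
  have habs : |g x.1| ≤ C * Real.exp (-(ρ x.1)) := abs_le_of_sq_le_sq hsq hCexp
  rw [hgval x] at habs
  simpa [hρ, hC] using habs

/-! ## §5 The weighted row bound of the wall Green's function -/

open Classical in
/-- **THE WALL OPERATOR IS BOUNDED FROM THE `(−2)`-WEIGHTED SUP NORM TO THE SUP NORM, WITH A CONSTANT OF `d, L` ONLY.**  Under the hypotheses of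
`wall_green_decay` (and `δ′ > 0`): for every lattice function `u` with `|u(z)| ≤ N·η⁻²` on `W` (the level-0 reading of `|u|₍₋₂₎ ≤ N`; at level-1 sites the
consumer's `N·(Lη)⁻²` is smaller) and every `x ∈ W`,
`|Σ_{z∈W} G(x,z)u(z)| ≤ L²∕(a₀(1 − θ))·c₀(δ′∕L)^d·N`, `c₀(c) = Σ_{m∈ℤ}e^{−c|m|}` ([B6] p. 233).  This is (1.101)'s function bound for the wall piece of
the two-region parametrix, uniform in `η, k, M, R₁M₁` and in the size of `W`. [cite: Balaban1985RegularSpaces, (1.101) p.93, p.98; Balaban1984PropagatorsII, p.228, Lemma 2.1 (2.61) p.234, p.233] -/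
theorem wall_rowBound (hd : 0 < d) {η : ℝ} (hη : η ≠ 0) {L : ℕ} (hL : 1 ≤ L) (m : ℕ) (Λs : ℕ → Set (Fin d → ℤ)) (a : ℕ → ℝ)
    (ha : ∀ j, 0 < a j) (K : (Fin d → ℤ) → (Fin d → ℤ) → ℝ)
    (hK : ∀ x z, K x z = ((η ^ 2)⁻¹ * ∑ μ : Fin d, ((2 : ℝ) * (if z = x then (1 : ℝ) else 0) - (if z = x + e μ then (1 : ℝ) else 0)
        - (if z = x - e μ then (1 : ℝ) else 0))) +
        (∑ j ∈ Finset.range (m + 1), (if blockMap (L ^ j) x ∈ Λs j ∧ blockMap (L ^ j) z = blockMap (L ^ j) x then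
          a j * ((((L : ℝ) ^ d)⁻¹) ^ j) ^ 2 else 0)))
    (W : Finset (Fin d → ℤ))
    (hfull : ∀ j, j ≤ m → ∀ x ∈ W, blockMap (L ^ j) x ∈ Λs j → ∀ z, blockMap (L ^ j) z = blockMap (L ^ j) x → z ∈ W)
    (hdisj : ∀ x ∈ W, ∀ j, j ≤ m → ∀ j', j' ≤ m → blockMap (L ^ j) x ∈ Λs j → blockMap (L ^ j') x ∈ Λs j' → j = j')
    (hcover : ∀ x ∈ W, ∃ j, j ≤ m ∧ blockMap (L ^ j) x ∈ Λs j)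
    (hlow : ∀ x ∈ W, ∀ j, j ≤ m → blockMap (L ^ j) x ∈ Λs j → j ≤ 1)
    {a₀ : ℝ} (ha₀ : 0 < a₀) (ha₀8 : a₀ ≤ 8) (hlo : ∀ j, j ≤ m → a₀ ≤ a j * η ^ 2 * ((L : ℝ) ^ j) ^ 2 * (((L : ℝ) ^ d) ^ j)⁻¹)
    (hhi : ∀ j, j ≤ m → a j * η ^ 2 * ((L : ℝ) ^ j) ^ 2 * (((L : ℝ) ^ d) ^ j)⁻¹ ≤ 8)
    {δ' θ : ℝ} (hδpos : 0 < δ') (hδ1 : δ' ≤ 1) (hδd : (d : ℝ) * δ' ≤ 1) (hδa : 4 * (d : ℝ) * δ' ^ 2 ≤ θ * a₀)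
    (hδθ : 2 * (d : ℝ) ^ 2 * δ' ^ 2 ≤ θ) (hθ1 : θ < 1)
    (u : (Fin d → ℤ) → ℝ) {N : ℝ} (hN : 0 ≤ N) (hu : ∀ z ∈ W, |u z| ≤ N * (η ^ 2)⁻¹) (x : ↥W) :
    |∑ z : ↥W, (Matrix.of fun x z : ↥W => K x.1 z.1)⁻¹ x z * u z.1|
      ≤ (L : ℝ) ^ 2 / (a₀ * (1 - θ)) * B6.c0 1 (δ' / L) ^ d * N := by
  have hL0 : (0 : ℝ) < L := by exact_mod_cast hL
  have hθ0 : 0 < 1 - θ := by linarith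
  have hc : 0 < δ' / L := by positivity
  set G := (Matrix.of fun x z : ↥W => K x.1 z.1)⁻¹ with hG
  -- termwise bound
  have hterm : ∀ z : ↥W, |G x z * u z.1|
      ≤ (L : ℝ) ^ 2 / (a₀ * (1 - θ)) * N * Real.exp (-(δ' / L * (l1dist x.1 z.1 : ℝ))) := by
    intro z
    rw [abs_mul]
    have h1 := wall_green_decay hd hη hL m Λs a ha K hK W hfull hdisj hcover hlow ha₀ ha₀8 hlo hhi hδpos.le hδ1 hδd hδa hδθ hθ1 x z
    have h2 := hu z.1 z.2
    calc |G x z| * |u z.1|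
        ≤ (((L : ℝ) * η) ^ 2 / (a₀ * (1 - θ)) * Real.exp (-(δ' / L * (l1dist x.1 z.1 : ℝ)))) * (N * (η ^ 2)⁻¹) :=
          mul_le_mul h1 h2 (abs_nonneg _) (by positivity)
      _ = (L : ℝ) ^ 2 / (a₀ * (1 - θ)) * N * Real.exp (-(δ' / L * (l1dist x.1 z.1 : ℝ))) := by
          field_simp
  calc |∑ z : ↥W, G x z * u z.1|
      ≤ ∑ z : ↥W, |G x z * u z.1| := Finset.abs_sum_le_sum_abs _ _
    _ ≤ ∑ z : ↥W, (L : ℝ) ^ 2 / (a₀ * (1 - θ)) * N * Real.exp (-(δ' / L * (l1dist x.1 z.1 : ℝ))) :=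
        Finset.sum_le_sum fun z _ => hterm z
    _ = (L : ℝ) ^ 2 / (a₀ * (1 - θ)) * N * ∑ z ∈ W, Real.exp (-(δ' / L * (l1dist x.1 z : ℝ))) := by
        rw [← Finset.mul_sum, ← Finset.sum_coe_sort W (fun z => Real.exp (-(δ' / L * (l1dist x.1 z : ℝ))))]
    _ ≤ (L : ℝ) ^ 2 / (a₀ * (1 - θ)) * N * B6.c0 1 (δ' / L) ^ d :=
        mul_le_mul_of_nonneg_left (sum_exp_l1dist_le hc W x.1) (by positivity)
    _ = (L : ℝ) ^ 2 / (a₀ * (1 - θ)) * B6.c0 1 (δ' / L) ^ d * N := by ring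

end Literature.MathematicalPhysics.QuantumFieldTheory.Balaban1983to89.B8Eq191FlatDirichletWall
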